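import Literature.Probability.LatticeModels.ConformalCovariance
import Mathlib.Analysis.SpecialFunctions.Pow.Real
import Mathlib.Analysis.SpecialFunctions.Trigonometric.Basic
import Mathlib.Analysis.InnerProductSpace.PiL2
import HarnessLib

/-!
# Objects of the line `Sketch` (§1, card `complex-circle-rotation-liouville`) for the crux `MoebiusLimitExists`
(item stmt-CriticalPhenomena-1344; `Summit.CriticalPhenomena.Ising3DConformalLimit.Theses.PerfectScreening.MoebiusLimitExists`
= `…Theses.EnergyNotSigmaSquared.MoebiusLimit`, one term)

Route-posited objects (D-0016: definitions a line posits live in a reviewed `…Defs` file, never inside a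
proof file). The line (lead `prover-line-stmt-CriticalPhenomena-1344-a1-0`; card
`Cruxes/MoebiusLimitExists/Ideas/complex-circle-rotation-liouville.md`, ideator sketch
`Cruxes/MoebiusLimitExists/Round2Ideator4Sketch.lean` §1) takes the witness `S` (weight `Δ`) of the existence
item stmt-CriticalPhenomena-1981 and reduces the one missing clause of the crux — covariance under the unit
inversion `ι : x ↦ x/‖x‖²` (`MoebiusLimitExistsNegative.moebiusLimit_iff_inversion`) — to a statement about ONE
function of ONE variable per configuration: the ELLIPTIC MÖBIUS FLOW `h_ψ` ("rotation by the angle `ψ` about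
the unit circle `{x₂ = 0, ‖x‖ = 1}`", the stereographic pull-back of a rotation of `S³`) is `2π`-periodic, is
the identity at `ψ = 0` and is `ι ∘ R₃` (`R₃` = the free sign flip of the third coordinate) at `ψ = π`, with
linear conformal factor `2 / D(y, ψ)`; so the WEIGHTED ORBIT FUNCTION
`F_x(ψ) = ∏ᵢ (2 / D(xᵢ, ψ))^Δ · S n (h_ψ ∘ x)` satisfies `F_x(0) = S n x` and
`F_x(π) = ∏ᵢ ‖xᵢ‖^{-2Δ} · S n (ι ∘ R₃ ∘ x)`, and inversion covariance of `S` at `x` is the single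
equation `F_x(π) = F_x(0)`, which holds as soon as `F_x` is the restriction of a `2π`-periodic entire
function of tempered growth (Liouville). The statement that it is (`OrbitEntire`) is the line's bet.

Contents (real-variable versions of the sketch's objects; the complex angle enters only through
`OrbitEntire`): `flowDen` (`D`), `flowNum`, `ellipticFlow` (`h_ψ`), `flipThree` (`R₃` as a linear
isometry), `OrbitGood` (injective configurations off the `x₂`-axis, where `D > 0` at every real angle),
`orbitWeight`, `orbitFun` (`F_x` on `ℝ`), `OrbitEntire`, and the definitional sanity lemmas
`flipThree_apply`, `mem_orbitGood`, `flowDen_at_zero` (registered anchor), `flowDen_at_pi`. The mathematics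
of the line is in the stub files `Theorems/EnergyNotSigmaSquaredMoebiusLimitExistsOrbitLiouville*.lean`
that import this module.

References: Möbius covariance and the unit inversion as in Di Francesco–Mathieu–Sénéchal 1997 §4.1,
§4.3.1 (tree `Literature.Probability.LatticeModels.ConformalCovariance`); the elliptic one-parameter
subgroups of the Möbius group of `ℝ³ ∪ {∞}` ("rotations about a circle"), Benedetti–Petronio,
Lectures on Hyperbolic Geometry (1992), ch. A — here written out in coordinates, so every claim about
`h_ψ` used by the line is a finite identity between rational functions of `y` and `cos ψ, sin ψ`.
-/

noncomputable section

open Set Function EuclideanGeometry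
open Literature.Probability.LatticeModels

namespace Summit.CriticalPhenomena.Ising3DConformalLimit.MoebiusLimitExistsOrbitLiouville

/-! ### The elliptic flow about the unit circle -/

/-- Denominator of the elliptic flow, `D(y, ψ) = (‖y‖² + 1) − 2 y₂ sin ψ − (‖y‖² − 1) cos ψ`
(stereographic pull-back of the rotation by `ψ` in the `(x₂, x₃)`-plane of `S³ ⊂ ℝ⁴`; the linear
conformal factor of the flow at `y` is `2 / D(y, ψ)`). [folklore] -/
def flowDen (y : EuclideanSpace ℝ (Fin 3)) (ψ : ℝ) : ℝ :=
  (‖y‖ ^ 2 + 1) - 2 * y 2 * Real.sin ψ - (‖y‖ ^ 2 - 1) * Real.cos ψ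

/-- Numerator of the elliptic flow, `N(y, ψ) = (2y₀, 2y₁, 2y₂ cos ψ − (‖y‖² − 1) sin ψ)`. [folklore] -/
def flowNum (y : EuclideanSpace ℝ (Fin 3)) (ψ : ℝ) : EuclideanSpace ℝ (Fin 3) :=
  WithLp.toLp 2 ![2 * y 0, 2 * y 1, 2 * y 2 * Real.cos ψ - (‖y‖ ^ 2 - 1) * Real.sin ψ]

/-- The elliptic Möbius flow `h_ψ(y) = N(y, ψ) / D(y, ψ)`, "rotation by `ψ` about the unit circle
`{x₂ = 0, ‖x‖ = 1}`" (junk value where `D = 0`, which for real `ψ` happens only for `y` on the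
`x₂`-axis). [folklore] -/
def ellipticFlow (ψ : ℝ) (y : EuclideanSpace ℝ (Fin 3)) : EuclideanSpace ℝ (Fin 3) :=
  (flowDen y ψ)⁻¹ • flowNum y ψ

/-- The coordinate sign flip `R₃ : (y₀, y₁, y₂) ↦ (y₀, y₁, −y₂)` as a linear isometry of `ℝ³` (a free
symmetry of every pointwise limit of `criticalCorr 3`, `MoebiusLimitExistsNegative.limit_signFlip`).
[folklore] -/
def flipThree : EuclideanSpace ℝ (Fin 3) ≃ₗᵢ[ℝ] EuclideanSpace ℝ (Fin 3) :=
  LinearIsometryEquiv.piLpCongrRight 2 fun j =>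
    if j = 2 then LinearIsometryEquiv.neg ℝ else LinearIsometryEquiv.refl ℝ ℝ

/-- Coordinates of the sign flip `R₃`. [folklore] -/
theorem flipThree_apply (y : EuclideanSpace ℝ (Fin 3)) (j : Fin 3) :
    flipThree y j = if j = 2 then -y j else y j := by
  simp only [flipThree, LinearIsometryEquiv.piLpCongrRight_apply]
  by_cases h : j = 2
  · subst h; simp
  · simp [h]

/-! ### Orbit functions -/

/-- Configurations in general position for the orbit argument: pairwise distinct points, all off the
`x₂`-axis (so that `D(xᵢ, ψ) > 0` at every real angle: no point passes through `∞`). [folklore] -/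
def OrbitGood (n : ℕ) : Set (Fin n → EuclideanSpace ℝ (Fin 3)) :=
  {x | Function.Injective x ∧ ∀ i, x i 0 ≠ 0 ∨ x i 1 ≠ 0}

/-- Membership in `OrbitGood`. [folklore] -/
@[simp] theorem mem_orbitGood {n : ℕ} (x : Fin n → EuclideanSpace ℝ (Fin 3)) :
    x ∈ OrbitGood n ↔ Function.Injective x ∧ ∀ i, x i 0 ≠ 0 ∨ x i 1 ≠ 0 := Iff.rfl

/-- The weight `∏ᵢ (2 / D(xᵢ, ψ))^Δ` (product of the `Δ`-th powers of the linear conformal factors of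
`h_ψ` at the points of the configuration). [folklore] -/
def orbitWeight (Δ : ℝ) (n : ℕ) (x : Fin n → EuclideanSpace ℝ (Fin 3)) (ψ : ℝ) : ℝ :=
  ∏ i, (2 / flowDen (x i) ψ) ^ Δ

/-- The weighted orbit function at a real angle,
`F_x(ψ) = ∏ᵢ (2 / D(xᵢ, ψ))^Δ · S n (h_ψ x₀, …, h_ψ x_{n-1})`; covariance of weight `Δ` under the
elliptic one-parameter group says exactly that `F_x` is constant (`= F_x(0) = S n x`).
[cite: FrancescoMathieuSenechal1997, §4.3.1 eq. (4.62)] -/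
def orbitFun (Δ : ℝ) (S : CorrFamily 3) (n : ℕ) (x : Fin n → EuclideanSpace ℝ (Fin 3)) (ψ : ℝ) : ℝ :=
  orbitWeight Δ n x ψ * S n fun i => ellipticFlow ψ (x i)

/-- ORBIT-ENTIRE (the line's transfer target): for every good configuration the weighted orbit
function is the restriction to `ℝ` of an entire function of the angle with at most polynomial growth
in `|Im ψ|`. For a Möbius-covariant family it holds trivially (`F_x` is constant); the line bets that it
holds for the normalised limit of item stmt-CriticalPhenomena-1981 (OS tube holomorphy + orbit geometry
+ weighted regularity at complex infinity, see the card). [folklore] -/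
def OrbitEntire (Δ : ℝ) (S : CorrFamily 3) : Prop :=
  ∀ n (x : Fin n → EuclideanSpace ℝ (Fin 3)), x ∈ OrbitGood n →
    ∃ F : ℂ → ℂ, Differentiable ℂ F ∧ (∃ (C : ℝ) (N : ℕ), ∀ z, ‖F z‖ ≤ C * (1 + |z.im|) ^ N) ∧
      ∀ ψ : ℝ, F ψ = (orbitFun Δ S n x ψ : ℂ)

/-! ### Definitional sanity checks -/

/-- At angle `0` the denominator is `2` (so the weight is `1` and `h_0 = id`). Registered anchor of
this objects file. [folklore] -/
theorem flowDen_at_zero : ∀ y : EuclideanSpace ℝ (Fin 3), flowDen y 0 = 2 := by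
  intro y
  simp only [flowDen, Real.sin_zero, Real.cos_zero]
  ring

/-- At angle `π` the denominator is `2‖y‖²` (so the weight is `‖y‖^{-2Δ}` per point, the conformal
factor of the unit inversion). [folklore] -/
theorem flowDen_at_pi (y : EuclideanSpace ℝ (Fin 3)) : flowDen y Real.pi = 2 * ‖y‖ ^ 2 := by
  simp only [flowDen, Real.sin_pi, Real.cos_pi]
  ring

end Summit.CriticalPhenomena.Ising3DConformalLimit.MoebiusLimitExistsOrbitLiouville

end
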